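import Literature.MathematicalPhysics.QuantumManyBody.BogoliubovWeylCalculus
import HarnessLib

/-!
# Weyl reduction of the conjugated functional: `A_p = B_p + √N₀[p=z]`, `B_p = γ_pa_p + σ_pa†_{σp}`,
# and the expansion of `∑ w_p‖A_pξ‖²`, `∑ c ⟨A_qA_pξ, A_{q'}A_{p'}ξ⟩` in powers of `√N₀` for `a_zξ = 0`

Topic `Literature/MathematicalPhysics/QuantumManyBody`, namespace `BoseGas.Fock`; sequel of
`BogoliubovWeylCalculus.lean` (the conjugated annihilator
`conjAn z σ P N₀ t q = A_q = γ_qa_q + σ_qa†_{σq} + √N₀[q = z] = T*W*a_qWT`) written for the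
provefact `Literature.MathematicalPhysics.QuantumManyBody.BoseGas.BastiCenatiempoSchlein2021_upperBound`.
The energy of the trial state `W(N₀)T_νξ` is `⟨ξ, 𝒢ξ⟩/‖ξ‖²` with
`⟨ξ, 𝒢ξ⟩ = ∑_p ε(p)‖A_pξ‖² + (2L³)⁻¹Re∑ c ⟨A_qA_pξ, A_{q'}A_{p'}ξ⟩`
(`BogoliubovWeylTrialFunctional.lean`). Here the Weyl operator is taken out: with the **Bogoliubov
annihilator** `B_q = γ_qa_q + σ_qa†_{σq} = T*a_qT` (`bogAn`, [BastiCenatiempoSchlein2021, (2.11)])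
and the condensate amplitude `s_q = √N₀[q = z]` (`condShift`, [ibid., (2.2), (3.2):
`W*a_pW = a_p + √N₀δ_{p,0}`]) one has `A_q = B_q + s_q` (`conjAn_eq`) and, for a vector without
condensate excitations (`a_zξ = 0`, as for `ξ_ν` in [ibid., §3–4]: "since `T_ν` does not act on
the zero momentum mode and since `a_0ξ_ν = 0`"), every `B`-word containing the index `z` kills `ξ`
(`bogAn_bogAn_z`, `bogAn_z_bogAn`). Consequently:

* `sum_mul_fockInner_conjAn_self_re`: `∑_p w_p‖A_pξ‖² = ∑_p w_p‖B_pξ‖²` whenever `w_z = 0`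
  (kinetic energy: `ε(0) = 0`), i.e. `T*W*𝒦WT = T*𝒦T` on such `ξ`;
* `sum_fockInner_conjPair_conjPair`: for every coefficient `c(p,q,p',q')`,
  `∑ c⟨A_qA_pξ, A_{q'}A_{p'}ξ⟩ = ∑ c⟨B_qB_pξ, B_{q'}B_{p'}ξ⟩ + √N₀·(cubic B-terms)
   + N₀·(quadratic B-terms) + N₀^{3/2}·(linear B-terms) + N₀²c(z,z,z,z)‖ξ‖²`,
  the substitution `a_0, a†_0 → √N₀` producing the decomposition
  `W*ℋ_NW = ℒ^{(0)}_N + ℒ^{(1)}_N + ℒ^{(2)}_N + ℒ^{(3)}_N + ℒ^{(4)}_N` of [ibid., (3.2)] followed by the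
  Bogoliubov conjugation `𝒢^{(j)}_N = T*ℒ^{(j)}_NT` of [ibid., §4], written as one exact identity of
  finite sums (all sixteen sesquilinear cross terms; the one-sided expansions are
  `sum_fockInner_conjAn_conjAn_left` / `_right`).

## References

* [BastiCenatiempoSchlein2021] G. Basti, S. Cenatiempo, B. Schlein, Forum Math. Sigma 9 (2021) e74,
  arXiv:2101.06222: (2.2), (2.11), (3.1)–(3.2), §4 (first display: `a_0ξ_ν = 0`).
-/

noncomputable section

namespace Literature.MathematicalPhysics.QuantumManyBody.BoseGas

open Complex MvPolynomial Finset
open scoped ComplexConjugate BigOperators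

namespace Fock

variable {ι : Type*} [DecidableEq ι] {z : ι} {σ : ι → ι} {P : Finset ι} {N₀ : ℝ} {t : ι → ℝ}

/-! ### The Bogoliubov annihilator `B_q` and the condensate amplitude `s_q` -/

/-- The **Bogoliubov annihilator** `B_q = γ_q a_q + σ_q a†_{σq} = T*_ν a_q T_ν` acting on
finite-excitation vectors. [cite: BastiCenatiempoSchlein2021, (2.11)] -/
def bogAn (σ : ι → ι) (P : Finset ι) (t : ι → ℝ) (q : ι) : Module.End ℂ (MvPolynomial ι ℂ) :=
  ((bogGamma σ P t q : ℝ) : ℂ) • an q + ((bogSigma σ P t q : ℝ) : ℂ) • cr (σ q)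

/-- The **condensate amplitude** `s_q = √N₀ [q = z]` (`W*_{N₀} a_q W_{N₀} = a_q + s_q`).
[cite: BastiCenatiempoSchlein2021, (2.2)] -/
def condShift (z : ι) (N₀ : ℝ) (q : ι) : ℝ := if q = z then Real.sqrt N₀ else 0

/-- `B_q ξ = γ_q ∂_qξ + σ_q X_{σq}ξ`. [cite: BastiCenatiempoSchlein2021, (2.11)] -/
theorem bogAn_apply (q : ι) (ξ : MvPolynomial ι ℂ) :
    bogAn σ P t q ξ = C ((bogGamma σ P t q : ℝ) : ℂ) * pderiv q ξ +
      C ((bogSigma σ P t q : ℝ) : ℂ) * (X (σ q) * ξ) := by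
  simp only [bogAn, LinearMap.add_apply, LinearMap.smul_apply, an_apply, cr_apply, smul_eq_C_mul]

/-- `s_z = √N₀`. [folklore] -/
theorem condShift_z (z : ι) (N₀ : ℝ) : condShift z N₀ z = Real.sqrt N₀ := if_pos rfl

/-- `s_q = 0` for `q ≠ z`. [folklore] -/
theorem condShift_of_ne {q : ι} (hq : q ≠ z) : condShift z N₀ q = 0 := if_neg hq

/-- **`A_q = B_q + s_q`.** [cite: BastiCenatiempoSchlein2021, (2.2), (2.11)] -/
theorem conjAn_eq (q : ι) (ξ : MvPolynomial ι ℂ) :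
    conjAn z σ P N₀ t q ξ = bogAn σ P t q ξ + C ((condShift z N₀ q : ℝ) : ℂ) * ξ := by
  simp only [conjAn, bogAn, condShift, LinearMap.add_apply, LinearMap.smul_apply, LinearMap.id_apply,
    smul_eq_C_mul]

/-- **`B_z = a_z`** (`γ_z = 1`, `σ_z = 0`). [folklore] -/
theorem bogAn_z (hP : ∀ p ∈ P, σ p ∉ P) (hσz : σ z = z) (ξ : MvPolynomial ι ℂ) :
    bogAn σ P t z ξ = pderiv z ξ := by
  rw [bogAn_apply, bogGamma_z hP hσz, bogSigma_z hP hσz]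
  simp

/-- `a_z` commutes with `B_q` for `q ≠ z`. [folklore] -/
theorem pderiv_z_bogAn (hσ : Function.Involutive σ) (hσz : σ z = z) {q : ι} (hq : q ≠ z)
    (ξ : MvPolynomial ι ℂ) : pderiv z (bogAn σ P t q ξ) = bogAn σ P t q (pderiv z ξ) := by
  have hσq : σ q ≠ z := fun h => hq (by rw [← hσ q, h, hσz])
  have hcomm : pderiv z (pderiv q ξ) = pderiv q (pderiv z ξ) := an_an_comm z q ξ
  rw [bogAn_apply, bogAn_apply, map_add, pderiv_C_mul, pderiv_C_mul, pderiv_mul, pderiv_X,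
    Pi.single_apply, if_neg hσq, zero_mul, zero_add, hcomm]

/-- **`B_q B_z ξ = 0` when `a_zξ = 0`.** [cite: BastiCenatiempoSchlein2021, §4 (`a_0ξ_ν = 0`)] -/
theorem bogAn_bogAn_z (hP : ∀ p ∈ P, σ p ∉ P) (hσz : σ z = z) {ξ : MvPolynomial ι ℂ}
    (hξ : pderiv z ξ = 0) (q : ι) : bogAn σ P t q (bogAn σ P t z ξ) = 0 := by
  rw [bogAn_z hP hσz, hξ, map_zero]

/-- **`B_z B_p ξ = 0` when `a_zξ = 0`.** [cite: BastiCenatiempoSchlein2021, §4 (`a_0ξ_ν = 0`)] -/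
theorem bogAn_z_bogAn (hσ : Function.Involutive σ) (hP : ∀ p ∈ P, σ p ∉ P) (hσz : σ z = z)
    {ξ : MvPolynomial ι ℂ} (hξ : pderiv z ξ = 0) (p : ι) : bogAn σ P t z (bogAn σ P t p ξ) = 0 := by
  by_cases hp : p = z
  · subst hp; exact bogAn_bogAn_z hP hσz hξ _
  · rw [bogAn_z hP hσz, pderiv_z_bogAn hσ hσz hp, hξ, map_zero]

/-- `B_z ξ = 0` when `a_zξ = 0`. [folklore] -/
theorem bogAn_z_of (hP : ∀ p ∈ P, σ p ∉ P) (hσz : σ z = z) {ξ : MvPolynomial ι ℂ}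
    (hξ : pderiv z ξ = 0) : bogAn σ P t z ξ = 0 := by
  rw [bogAn_z hP hσz, hξ]

/-! ### The two-fold conjugated annihilation `A_qA_pξ` -/

/-- **`A_qA_pξ = B_qB_pξ + s_pB_qξ + s_qB_pξ + s_ps_qξ`.** [cite: BastiCenatiempoSchlein2021, (3.2)] -/
theorem conjAn_conjAn (p q : ι) (ξ : MvPolynomial ι ℂ) :
    conjAn z σ P N₀ t q (conjAn z σ P N₀ t p ξ) =
      bogAn σ P t q (bogAn σ P t p ξ) + C ((condShift z N₀ p : ℝ) : ℂ) * bogAn σ P t q ξ +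
        C ((condShift z N₀ q : ℝ) : ℂ) * bogAn σ P t p ξ +
        C ((condShift z N₀ p * condShift z N₀ q : ℝ) : ℂ) * ξ := by
  rw [conjAn_eq, conjAn_eq, map_add]
  have h : bogAn σ P t q (C ((condShift z N₀ p : ℝ) : ℂ) * ξ) =
      C ((condShift z N₀ p : ℝ) : ℂ) * bogAn σ P t q ξ := by
    rw [← smul_eq_C_mul, ← smul_eq_C_mul, map_smul]
  rw [h]
  push_cast
  rw [map_mul]
  ring

/-! ### The kinetic form: `∑_p w_p ‖A_pξ‖² = ∑_p w_p ‖B_pξ‖²` for `w_z = 0` -/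

/-- **Weyl reduction of the kinetic form**: since `A_p = B_p` for `p ≠ z` and the weight vanishes at
the condensate mode (`ε(0) = 0`), `∑_p w_p‖A_pξ‖² = ∑_p w_p‖B_pξ‖²`, i.e. `W*𝒦W = 𝒦` in `T*·T`.
[cite: BastiCenatiempoSchlein2021, (3.2) (`ℒ^{(2)}_N ∋ 𝒦`)] -/
theorem sum_mul_fockInner_conjAn_self_re [Fintype ι] (w : ι → ℝ) (hw : w z = 0)
    (ξ : MvPolynomial ι ℂ) :
    ∑ p, w p * (fockInner (conjAn z σ P N₀ t p ξ) (conjAn z σ P N₀ t p ξ)).re =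
      ∑ p, w p * (fockInner (bogAn σ P t p ξ) (bogAn σ P t p ξ)).re := by
  refine Finset.sum_congr rfl fun p _ => ?_
  by_cases hp : p = z
  · rw [hp, hw, zero_mul, zero_mul]
  · rw [conjAn_eq, condShift_of_ne hp]
    simp

/-! ### The quartic form: expansion in powers of `√N₀` -/

section Quartic

variable [Fintype ι]

/-- The delta collapse `∑_p s_p f(p) = √N₀ f(z)`. [folklore] -/
theorem sum_condShift_mul (f : ι → ℂ) :
    ∑ p, ((condShift z N₀ p : ℝ) : ℂ) * f p = (Real.sqrt N₀ : ℂ) * f z := by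
  rw [Finset.sum_eq_single z (fun p _ hp => by rw [condShift_of_ne hp]; simp)
    (fun h => absurd (Finset.mem_univ z) h), condShift_z]

omit [DecidableEq ι] [Fintype ι] in
/-- `⟨C a·u, v⟩ = conj(a)⟨u, v⟩`. [folklore] -/
theorem fockInner_C_mul_left (a : ℂ) (u v : MvPolynomial ι ℂ) :
    fockInner (C a * u) v = conj a * fockInner u v := by
  rw [← smul_eq_C_mul, fockInner_smul_left]

omit [DecidableEq ι] [Fintype ι] in
/-- `⟨u, C a·v⟩ = a⟨u, v⟩`. [folklore] -/
theorem fockInner_C_mul_right (a : ℂ) (u v : MvPolynomial ι ℂ) :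
    fockInner u (C a * v) = a * fockInner u v := by
  rw [← smul_eq_C_mul, fockInner_smul_right]

/-- **Right expansion against one vector**: for any `d(p',q')` and `w`,
`∑ d ⟨w, A_{q'}A_{p'}ξ⟩ = ∑ d ⟨w, B_{q'}B_{p'}ξ⟩ + √N₀∑_{q'} d(z,q')⟨w, B_{q'}ξ⟩
  + √N₀∑_{p'} d(p',z)⟨w, B_{p'}ξ⟩ + N₀ d(z,z)⟨w, ξ⟩` (`N₀ ≥ 0`). [cite: BastiCenatiempoSchlein2021, (3.2)] -/
theorem sum_fockInner_conjAn_conjAn_right (hN₀ : 0 ≤ N₀) (d : ι → ι → ℂ)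
    (w ξ : MvPolynomial ι ℂ) :
    ∑ p', ∑ q', d p' q' * fockInner w (conjAn z σ P N₀ t q' (conjAn z σ P N₀ t p' ξ)) =
      ∑ p', ∑ q', d p' q' * fockInner w (bogAn σ P t q' (bogAn σ P t p' ξ)) +
      (Real.sqrt N₀ : ℂ) * ∑ q', d z q' * fockInner w (bogAn σ P t q' ξ) +
      (Real.sqrt N₀ : ℂ) * ∑ p', d p' z * fockInner w (bogAn σ P t p' ξ) +
      (N₀ : ℂ) * (d z z * fockInner w ξ) := by
  simp only [conjAn_conjAn, fockInner_add_right, fockInner_C_mul_right, mul_add,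
    Finset.sum_add_distrib]
  have h1 : ∑ p', ∑ q', d p' q' * (((condShift z N₀ p' : ℝ) : ℂ) * fockInner w (bogAn σ P t q' ξ)) =
      (Real.sqrt N₀ : ℂ) * ∑ q', d z q' * fockInner w (bogAn σ P t q' ξ) := by
    calc _ = ∑ p', ((condShift z N₀ p' : ℝ) : ℂ) * ∑ q', d p' q' * fockInner w (bogAn σ P t q' ξ) := by
            refine Finset.sum_congr rfl fun p' _ => ?_
            rw [Finset.mul_sum]
            refine Finset.sum_congr rfl fun q' _ => ?_
            ring
      _ = _ := sum_condShift_mul _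
  have h2 : ∑ p', ∑ q', d p' q' * (((condShift z N₀ q' : ℝ) : ℂ) * fockInner w (bogAn σ P t p' ξ)) =
      (Real.sqrt N₀ : ℂ) * ∑ p', d p' z * fockInner w (bogAn σ P t p' ξ) := by
    rw [Finset.mul_sum]
    refine Finset.sum_congr rfl fun p' _ => ?_
    calc _ = ∑ q', ((condShift z N₀ q' : ℝ) : ℂ) * (d p' q' * fockInner w (bogAn σ P t p' ξ)) := by
            refine Finset.sum_congr rfl fun q' _ => ?_
            ring
      _ = _ := sum_condShift_mul _
  have h3 : ∑ p', ∑ q', d p' q' * (((condShift z N₀ p' * condShift z N₀ q' : ℝ) : ℂ) * fockInner w ξ) =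
      (N₀ : ℂ) * (d z z * fockInner w ξ) := by
    calc _ = ∑ p', ((condShift z N₀ p' : ℝ) : ℂ) *
              ∑ q', ((condShift z N₀ q' : ℝ) : ℂ) * (d p' q' * fockInner w ξ) := by
            refine Finset.sum_congr rfl fun p' _ => ?_
            rw [Finset.mul_sum]
            refine Finset.sum_congr rfl fun q' _ => ?_
            push_cast
            ring
      _ = (Real.sqrt N₀ : ℂ) * ((Real.sqrt N₀ : ℂ) * (d z z * fockInner w ξ)) := by
            simp only [sum_condShift_mul]
      _ = _ := by rw [← mul_assoc, ← Complex.ofReal_mul, Real.mul_self_sqrt hN₀]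
  rw [h1, h2, h3]

/-- **Left expansion against a family**: for any `c(p,q,p',q')` and `G(p',q')`,
`∑ c ⟨A_qA_pξ, G⟩ = ∑ c ⟨B_qB_pξ, G⟩ + √N₀∑_{q,p',q'} c(z,q,p',q')⟨B_qξ, G⟩
  + √N₀∑_{p,p',q'} c(p,z,p',q')⟨B_pξ, G⟩ + N₀∑_{p',q'} c(z,z,p',q')⟨ξ, G⟩` (`N₀ ≥ 0`; the
condensate amplitudes are real). [cite: BastiCenatiempoSchlein2021, (3.2)] -/
theorem sum_fockInner_conjAn_conjAn_left (hN₀ : 0 ≤ N₀) (c : ι → ι → ι → ι → ℂ)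
    (G : ι → ι → MvPolynomial ι ℂ) (ξ : MvPolynomial ι ℂ) :
    ∑ p, ∑ q, ∑ p', ∑ q', c p q p' q' *
        fockInner (conjAn z σ P N₀ t q (conjAn z σ P N₀ t p ξ)) (G p' q') =
      ∑ p, ∑ q, ∑ p', ∑ q', c p q p' q' * fockInner (bogAn σ P t q (bogAn σ P t p ξ)) (G p' q') +
      (Real.sqrt N₀ : ℂ) * ∑ q, ∑ p', ∑ q', c z q p' q' * fockInner (bogAn σ P t q ξ) (G p' q') +
      (Real.sqrt N₀ : ℂ) * ∑ p, ∑ p', ∑ q', c p z p' q' * fockInner (bogAn σ P t p ξ) (G p' q') +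
      (N₀ : ℂ) * ∑ p', ∑ q', c z z p' q' * fockInner ξ (G p' q') := by
  simp only [conjAn_conjAn, fockInner_add_left, fockInner_C_mul_left, Complex.conj_ofReal, mul_add,
    Finset.sum_add_distrib]
  have h1 : ∑ p, ∑ q, ∑ p', ∑ q', c p q p' q' *
      (((condShift z N₀ p : ℝ) : ℂ) * fockInner (bogAn σ P t q ξ) (G p' q')) =
      (Real.sqrt N₀ : ℂ) * ∑ q, ∑ p', ∑ q', c z q p' q' * fockInner (bogAn σ P t q ξ) (G p' q') := by
    calc _ = ∑ p, ((condShift z N₀ p : ℝ) : ℂ) *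
              ∑ q, ∑ p', ∑ q', c p q p' q' * fockInner (bogAn σ P t q ξ) (G p' q') := by
            refine Finset.sum_congr rfl fun p _ => ?_
            simp only [Finset.mul_sum]
            refine Finset.sum_congr rfl fun q _ => Finset.sum_congr rfl fun p' _ =>
              Finset.sum_congr rfl fun q' _ => ?_
            ring
      _ = _ := sum_condShift_mul _
  have h2 : ∑ p, ∑ q, ∑ p', ∑ q', c p q p' q' *
      (((condShift z N₀ q : ℝ) : ℂ) * fockInner (bogAn σ P t p ξ) (G p' q')) =
      (Real.sqrt N₀ : ℂ) * ∑ p, ∑ p', ∑ q', c p z p' q' * fockInner (bogAn σ P t p ξ) (G p' q') := by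
    rw [Finset.mul_sum]
    refine Finset.sum_congr rfl fun p _ => ?_
    calc _ = ∑ q, ((condShift z N₀ q : ℝ) : ℂ) *
              ∑ p', ∑ q', c p q p' q' * fockInner (bogAn σ P t p ξ) (G p' q') := by
            refine Finset.sum_congr rfl fun q _ => ?_
            simp only [Finset.mul_sum]
            refine Finset.sum_congr rfl fun p' _ => Finset.sum_congr rfl fun q' _ => ?_
            ring
      _ = _ := sum_condShift_mul _
  have h3 : ∑ p, ∑ q, ∑ p', ∑ q', c p q p' q' *
      (((condShift z N₀ p * condShift z N₀ q : ℝ) : ℂ) * fockInner ξ (G p' q')) =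
      (N₀ : ℂ) * ∑ p', ∑ q', c z z p' q' * fockInner ξ (G p' q') := by
    calc _ = ∑ p, ((condShift z N₀ p : ℝ) : ℂ) * ∑ q, ((condShift z N₀ q : ℝ) : ℂ) *
              ∑ p', ∑ q', c p q p' q' * fockInner ξ (G p' q') := by
            refine Finset.sum_congr rfl fun p _ => ?_
            rw [Finset.mul_sum]
            refine Finset.sum_congr rfl fun q _ => ?_
            simp only [Finset.mul_sum]
            refine Finset.sum_congr rfl fun p' _ => Finset.sum_congr rfl fun q' _ => ?_
            push_cast
            ring
      _ = (Real.sqrt N₀ : ℂ) * ((Real.sqrt N₀ : ℂ) * ∑ p', ∑ q', c z z p' q' * fockInner ξ (G p' q')) := by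
            simp only [sum_condShift_mul]
      _ = _ := by rw [← mul_assoc, ← Complex.ofReal_mul, Real.mul_self_sqrt hN₀]
  rw [h1, h2, h3]

/-- **The Weyl reduction of the quartic form** (`a_zξ = 0` not needed for the identity itself):
for every coefficient `c(p,q,p',q')`,
`∑ c ⟨A_qA_pξ, A_{q'}A_{p'}ξ⟩ = ∑ c ⟨B_qB_pξ, B_{q'}B_{p'}ξ⟩ + √N₀·[cubic] + N₀·[quadratic]
  + N₀^{3/2}·[linear] + N₀² c(z,z,z,z)‖ξ‖²`, all sixteen sesquilinear cross terms of
`A = B + s` collapsed by `∑_p s_p f(p) = √N₀ f(z)` and grouped by the left factor. With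
`c = [p+q = p'+q'] V̂(p'-p)/(2N)` and momentum labels this is
`⟨ξ, T*(ℒ^{(0)}_N + ⋯ + ℒ^{(4)}_N)Tξ⟩` for the decomposition [ibid., (3.2)] of `W*ℋ_NW`
(interaction part), the starting point of [ibid., §4].
[cite: BastiCenatiempoSchlein2021, (3.1)–(3.2)] -/
theorem sum_fockInner_conjPair_conjPair (hN₀ : 0 ≤ N₀) (c : ι → ι → ι → ι → ℂ)
    (ξ : MvPolynomial ι ℂ) :
    ∑ p, ∑ q, ∑ p', ∑ q', c p q p' q' *
        fockInner (conjAn z σ P N₀ t q (conjAn z σ P N₀ t p ξ))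
          (conjAn z σ P N₀ t q' (conjAn z σ P N₀ t p' ξ)) =
      -- left factor `B_qB_pξ`
      (∑ p, ∑ q, ∑ p', ∑ q', c p q p' q' *
          fockInner (bogAn σ P t q (bogAn σ P t p ξ)) (bogAn σ P t q' (bogAn σ P t p' ξ)) +
        (Real.sqrt N₀ : ℂ) * ∑ p, ∑ q, ∑ q', c p q z q' *
          fockInner (bogAn σ P t q (bogAn σ P t p ξ)) (bogAn σ P t q' ξ) +
        (Real.sqrt N₀ : ℂ) * ∑ p, ∑ q, ∑ p', c p q p' z *
          fockInner (bogAn σ P t q (bogAn σ P t p ξ)) (bogAn σ P t p' ξ) +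
        (N₀ : ℂ) * ∑ p, ∑ q, c p q z z * fockInner (bogAn σ P t q (bogAn σ P t p ξ)) ξ) +
      -- left factor `s_pB_qξ`
      (Real.sqrt N₀ : ℂ) * (∑ q, ∑ p', ∑ q', c z q p' q' *
          fockInner (bogAn σ P t q ξ) (bogAn σ P t q' (bogAn σ P t p' ξ)) +
        (Real.sqrt N₀ : ℂ) * ∑ q, ∑ q', c z q z q' * fockInner (bogAn σ P t q ξ) (bogAn σ P t q' ξ) +
        (Real.sqrt N₀ : ℂ) * ∑ q, ∑ p', c z q p' z * fockInner (bogAn σ P t q ξ) (bogAn σ P t p' ξ) +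
        (N₀ : ℂ) * ∑ q, c z q z z * fockInner (bogAn σ P t q ξ) ξ) +
      -- left factor `s_qB_pξ`
      (Real.sqrt N₀ : ℂ) * (∑ p, ∑ p', ∑ q', c p z p' q' *
          fockInner (bogAn σ P t p ξ) (bogAn σ P t q' (bogAn σ P t p' ξ)) +
        (Real.sqrt N₀ : ℂ) * ∑ p, ∑ q', c p z z q' * fockInner (bogAn σ P t p ξ) (bogAn σ P t q' ξ) +
        (Real.sqrt N₀ : ℂ) * ∑ p, ∑ p', c p z p' z * fockInner (bogAn σ P t p ξ) (bogAn σ P t p' ξ) +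
        (N₀ : ℂ) * ∑ p, c p z z z * fockInner (bogAn σ P t p ξ) ξ) +
      -- left factor `s_ps_qξ`
      (N₀ : ℂ) * (∑ p', ∑ q', c z z p' q' * fockInner ξ (bogAn σ P t q' (bogAn σ P t p' ξ)) +
        (Real.sqrt N₀ : ℂ) * ∑ q', c z z z q' * fockInner ξ (bogAn σ P t q' ξ) +
        (Real.sqrt N₀ : ℂ) * ∑ p', c z z p' z * fockInner ξ (bogAn σ P t p' ξ) +
        (N₀ : ℂ) * (c z z z z * fockInner ξ ξ)) := by
  rw [sum_fockInner_conjAn_conjAn_left hN₀]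
  -- right expansions of the four groups
  have hR : ∀ (w : MvPolynomial ι ℂ) (d : ι → ι → ℂ),
      ∑ p', ∑ q', d p' q' * fockInner w (conjAn z σ P N₀ t q' (conjAn z σ P N₀ t p' ξ)) =
      ∑ p', ∑ q', d p' q' * fockInner w (bogAn σ P t q' (bogAn σ P t p' ξ)) +
      (Real.sqrt N₀ : ℂ) * ∑ q', d z q' * fockInner w (bogAn σ P t q' ξ) +
      (Real.sqrt N₀ : ℂ) * ∑ p', d p' z * fockInner w (bogAn σ P t p' ξ) +
      (N₀ : ℂ) * (d z z * fockInner w ξ) := fun w d => sum_fockInner_conjAn_conjAn_right hN₀ d w ξ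
  have hG0 : ∑ p, ∑ q, ∑ p', ∑ q', c p q p' q' *
      fockInner (bogAn σ P t q (bogAn σ P t p ξ)) (conjAn z σ P N₀ t q' (conjAn z σ P N₀ t p' ξ)) =
      ∑ p, ∑ q, ∑ p', ∑ q', c p q p' q' *
          fockInner (bogAn σ P t q (bogAn σ P t p ξ)) (bogAn σ P t q' (bogAn σ P t p' ξ)) +
        (Real.sqrt N₀ : ℂ) * ∑ p, ∑ q, ∑ q', c p q z q' *
          fockInner (bogAn σ P t q (bogAn σ P t p ξ)) (bogAn σ P t q' ξ) +
        (Real.sqrt N₀ : ℂ) * ∑ p, ∑ q, ∑ p', c p q p' z *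
          fockInner (bogAn σ P t q (bogAn σ P t p ξ)) (bogAn σ P t p' ξ) +
        (N₀ : ℂ) * ∑ p, ∑ q, c p q z z * fockInner (bogAn σ P t q (bogAn σ P t p ξ)) ξ := by
    simp only [hR, Finset.sum_add_distrib, Finset.mul_sum]
  have hG1 : ∑ q, ∑ p', ∑ q', c z q p' q' *
      fockInner (bogAn σ P t q ξ) (conjAn z σ P N₀ t q' (conjAn z σ P N₀ t p' ξ)) =
      ∑ q, ∑ p', ∑ q', c z q p' q' * fockInner (bogAn σ P t q ξ) (bogAn σ P t q' (bogAn σ P t p' ξ)) +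
        (Real.sqrt N₀ : ℂ) * ∑ q, ∑ q', c z q z q' * fockInner (bogAn σ P t q ξ) (bogAn σ P t q' ξ) +
        (Real.sqrt N₀ : ℂ) * ∑ q, ∑ p', c z q p' z * fockInner (bogAn σ P t q ξ) (bogAn σ P t p' ξ) +
        (N₀ : ℂ) * ∑ q, c z q z z * fockInner (bogAn σ P t q ξ) ξ := by
    simp only [hR, Finset.sum_add_distrib, Finset.mul_sum]
  have hG2 : ∑ p, ∑ p', ∑ q', c p z p' q' *
      fockInner (bogAn σ P t p ξ) (conjAn z σ P N₀ t q' (conjAn z σ P N₀ t p' ξ)) =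
      ∑ p, ∑ p', ∑ q', c p z p' q' * fockInner (bogAn σ P t p ξ) (bogAn σ P t q' (bogAn σ P t p' ξ)) +
        (Real.sqrt N₀ : ℂ) * ∑ p, ∑ q', c p z z q' * fockInner (bogAn σ P t p ξ) (bogAn σ P t q' ξ) +
        (Real.sqrt N₀ : ℂ) * ∑ p, ∑ p', c p z p' z * fockInner (bogAn σ P t p ξ) (bogAn σ P t p' ξ) +
        (N₀ : ℂ) * ∑ p, c p z z z * fockInner (bogAn σ P t p ξ) ξ := by
    simp only [hR, Finset.sum_add_distrib, Finset.mul_sum]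
  have hG3 := hR ξ (c z z)
  rw [hG0, hG1, hG2, hG3]

end Quartic


end Fock

end Literature.MathematicalPhysics.QuantumManyBody.BoseGas

end
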